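import Summits.ABC.ABC.Theorems.IsogenyGlueCongruenceDegreePrimesPolyBoundedNewPartSeparation
import Summits.ABC.ABC.Theorems.IsogenyGlueCongruenceDegreePrimesPolyBoundedStubGlue
import Mathlib.LinearAlgebra.FreeModule.Finite.CardQuotient
import HarnessLib

/-!
# Crux A `DegreePrimesPolyBounded` (stmt-ABC-2045), line `newpart-congruence-friability` —
# the KNOWN regime of the bet, E-free: congruence primes of two Galois orbits are
# `≤ N^{22 · d_P · d_Q}`

Registered sub-goal `stub_gradedProductRegime` (second lead, unit `line-stmt-ABC-2045-c1`): the
calibration theorem the line's bet `stub_gradedNewPartFriability` must beat.  For two distinct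
minimal primes `P ≠ Q` of `𝕋 = anemicHeckeRing N 2` (= two distinct Galois orbits of eigen-systems
of `S₂(Γ₀(N))`, new or old, ANY level `N ≥ 2`) every prime `ℓ` dividing the congruence modulus
`#𝕋/(P + Q) ≠ 0` satisfies `ℓ ≤ N^{22 · rank_ℤ(𝕋/P) · rank_ℤ(𝕋/Q)}`
(`le_pow_of_dvd_congruenceModulus`); for newforms `f, g` this is the bet's shape with the
PRODUCT `d_f · d_g` of the orbit dimensions in the exponent instead of `d_f`
(`stub_gradedProductRegime`, `κ = 22`, `C = 1`, no squarefree hypothesis).  The tree had the case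
`d_f = 1` only (`log_heckeCongruenceModulus_le_finrank_mul_three_mul_log`, partner's rank).

Proof (Pasten 2024, proof of Thm. 7.2, made uniform over Galois orbits):
* a SEPARATING Hecke element `t` of height `≤ 8 d_P d_Q N⁶` on which no complex point of
  `Spec 𝕋/P` agrees with a complex point of `Spec 𝕋/Q` (sibling file `…NewPartSeparation.lean`,
  `exists_separating_heckeElement`);
* `y = q(t) mod Q`, `q` the characteristic polynomial of `t` on `𝕋/P` (Cayley–Hamilton:
  `q(t) ∈ P`), is a NONZERO element of the image of `P` in the domain `𝕋/Q` (a zero would put a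
  complex point of `Spec 𝕋/Q` among the roots of `q`, which are values of `t` at complex points of
  `Spec 𝕋/P`, `exists_ringHom_apply_eq_of_isRoot_charpoly_lmul`);
* `#𝕋/(P+Q) = #(𝕋/Q)/P̄` divides `#(𝕋/Q)/(y) = |N(y)|` (`congruenceModulus_dvd_natAbs_norm`), and
  `|N(y)| ≤ (2 B_t)^{d_P d_Q}` where `|ψ(t)| ≤ B_t ≤ 8 d_P d_Q N⁶` at every complex point `ψ`
  (trivial Hecke bound `|ψ(T_p)| ≤ 2p`, `norm_ringHom_T_le_two_mul`), and `d ≤ 3 N⁴`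
  (`sum_finrank_quotient_minimalPrimes_two_le`).

## References

* [PastenShimura2024] H. Pasten, *Shimura curves and the abc conjecture*, J. Number Theory 254
  (2024) 214–335, §4.9–4.11 p. 16, Prop. 5.4 p. 17, proof of Thm. 7.2 p. 26.
* [Sturm1987] J. Sturm, *On the congruence of modular forms*, LNM 1240 (1987), Thm. 1.
-/

noncomputable section

open scoped MatrixGroups ModularForm
open CongruenceSubgroup UpperHalfPlane Polynomial

-- `Summit.<Summit>.<Problem>` is the mandated summit-side namespace (CONVENTIONS §2); for the
-- single-conjunct summit `ABC` the two coincide, so the duplicate `ABC.ABC` is deliberate.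
set_option linter.dupNamespace false

namespace Summit.ABC.ABC.Theorems.DegreePrimesPolyBounded

open Literature.NumberTheory.EllipticCurves.ModularForms

variable {N : ℕ} [NeZero N]

/-! ### Indices of principal ideals and the congruence modulus -/

/-- **The index of a principal ideal is the absolute norm**: for a domain `O`, free of finite rank
over `ℤ`, and `y ≠ 0`, `#(O ⧸ yO) = |N_{O/ℤ}(y)|` (multiplication by `y` is an additive
isomorphism `O ≃ yO`, Mathlib `Submodule.natAbs_det_equiv`). [folklore] -/
theorem natCard_quotient_span_singleton_eq_natAbs_norm {O : Type*} [CommRing O] [IsDomain O]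
    [Module.Free ℤ O] [Module.Finite ℤ O] {y : O} (hy : y ≠ 0) :
    Nat.card (O ⧸ Ideal.span {y}) = (Algebra.norm ℤ y).natAbs := by
  classical
  let I : Submodule ℤ O := (Ideal.span {y}).restrictScalars ℤ
  have hinj : Function.Injective (Algebra.lmul ℤ O y) := fun a b h ↦
    mul_left_cancel₀ hy (by simpa [Algebra.coe_lmul_eq_mul] using h)
  have hrange : LinearMap.range (Algebra.lmul ℤ O y) = I := by
    ext z
    simp only [LinearMap.mem_range, Algebra.coe_lmul_eq_mul, LinearMap.mul_apply', I,
      Submodule.restrictScalars_mem, Ideal.mem_span_singleton']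
    exact ⟨fun ⟨a, ha⟩ ↦ ⟨a, by rw [mul_comm]; exact ha⟩,
      fun ⟨a, ha⟩ ↦ ⟨a, by rw [mul_comm]; exact ha⟩⟩
  let e : O ≃ₗ[ℤ] I := (LinearEquiv.ofInjective _ hinj).trans (LinearEquiv.ofEq _ _ hrange)
  have hdet : LinearMap.det (I.subtype ∘ₗ AddMonoidHom.toIntLinearMap (e : O →+ I)) =
      Algebra.norm ℤ y := by
    rw [Algebra.norm_apply]
    congr 1
  have h := Submodule.natAbs_det_equiv I e
  rw [hdet] at h
  rw [h]
  exact Nat.card_congr (Submodule.Quotient.restrictScalarsEquiv ℤ (Ideal.span {y})).toEquiv.symm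

/-- **The congruence modulus divides the norm of any element of `P` read modulo `ker π`**
(Pasten 2024, Prop. 5.4, for a general base orbit): for a surjective ring map `π : R → O` onto a
domain free of finite rank over `ℤ`, `#R/(P + ker π) = #O/π(P)` divides `#O/(π y) = |N_{O/ℤ}(π y)|`
for every `y ∈ P` with `π y ≠ 0`. [cite: PastenShimura2024, Prop. 5.4 p. 17] -/
theorem congruenceModulus_ker_dvd_natAbs_norm {R O : Type*} [CommRing R] [CommRing O] [IsDomain O]
    [Module.Free ℤ O] [Module.Finite ℤ O] (π : R →+* O) (hπ : Function.Surjective π)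
    {P : Ideal R} {y : R} (hy : y ∈ P) (hy0 : π y ≠ 0) :
    congruenceModulus P (RingHom.ker π) ∣ (Algebra.norm ℤ (π y)).natAbs := by
  rw [congruenceModulus_comm, congruenceModulus_ker_eq_card π hπ P,
    ← natCard_quotient_span_singleton_eq_natAbs_norm hy0, ← Submodule.cardQuot_apply,
    ← Submodule.cardQuot_apply]
  refine AddSubgroup.index_dvd_of_le ?_
  change (Ideal.span {π y}).toAddSubgroup ≤ (P.map π).toAddSubgroup
  intro z hz
  have hz' : z ∈ Ideal.span {π y} := hz
  rw [Ideal.mem_span_singleton'] at hz'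
  obtain ⟨a, rfl⟩ := hz'
  exact Ideal.mul_mem_left _ a (Ideal.mem_map_of_mem _ hy)

/-- A ring map `O → ℂ` carries `q(x)` to `q(ψ x)` (`q ∈ ℤ[X]`). [folklore] -/
theorem ringHom_aeval_eq_eval_map {O : Type*} [CommRing O] (ψ : O →+* ℂ) (x : O) (q : ℤ[X]) :
    ψ (aeval x q) = (q.map (Int.castRingHom ℂ)).eval (ψ x) := by
  have h1 := Polynomial.aeval_algHom_apply ψ.toIntAlgHom x q
  simp only [RingHom.toIntAlgHom_coe] at h1
  rw [← h1, Polynomial.aeval_def, Polynomial.eval_map]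
  rfl

/-- **Characteristic polynomial data of `π(t)`** for a ring map `π : R → O` to a commutative ring
free of finite rank `d` over `ℤ`: a monic `q ∈ ℤ[X]` of degree `d` with `q(t) ∈ ker π`
(Cayley–Hamilton for multiplication by `π t` on `O`) all of whose complex roots are values of
`π t` under ring maps `O → ℂ` (`exists_ringHom_apply_eq_of_isRoot_charpoly_lmul`). [folklore] -/
theorem exists_monic_aeval_mem_ker {R O : Type*} [CommRing R] [CommRing O] [Module.Free ℤ O]
    [Module.Finite ℤ O] (π : R →+* O) (t : R) :
    ∃ q : ℤ[X], q.Monic ∧ q.natDegree = Module.finrank ℤ O ∧ aeval t q ∈ RingHom.ker π ∧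
      ∀ α : ℂ, (q.map (Int.castRingHom ℂ)).IsRoot α → ∃ ψ : O →+* ℂ, ψ (π t) = α := by
  refine ⟨(Algebra.lmul ℤ O (π t)).charpoly, LinearMap.charpoly_monic _,
    LinearMap.charpoly_natDegree _, ?_,
    fun α hα ↦ exists_ringHom_apply_eq_of_isRoot_charpoly_lmul (π t) hα⟩
  have hsx : aeval (π t) (Algebra.lmul ℤ O (π t)).charpoly = 0 := by
    have h := LinearMap.aeval_self_charpoly (Algebra.lmul ℤ O (π t))
    rw [Polynomial.aeval_algHom_apply (Algebra.lmul ℤ O) (π t)] at h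
    exact Algebra.lmul_injective (h.trans (map_zero _).symm)
  have h1 := Polynomial.aeval_algHom_apply π.toIntAlgHom t (Algebra.lmul ℤ O (π t)).charpoly
  simp only [RingHom.toIntAlgHom_coe] at h1
  rw [RingHom.mem_ker, ← h1]
  exact hsx

/-- **The size mechanism of Pasten's proof of Thm. 7.2, for a general base orbit.** Let
`π : R → O` be a surjective ring map onto a domain free of finite rank `d_O` over `ℤ`, `P` an
ideal of `R`, `t ∈ R`, and `q ∈ ℤ[X]` monic with `q(t) ∈ P` and `π(q(t)) ≠ 0`.  If `|ψ(π t)| ≤ Bₓ`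
for every ring map `ψ : O → ℂ` and every complex root of `q` has absolute value `≤ B_q`, then
every `ℓ` dividing `#R/(P + ker π)` satisfies `ℓ ≤ ((Bₓ + B_q)^{deg q})^{d_O}`:
`#R/(P + ker π) ∣ |N(π q(t))|` (`congruenceModulus_ker_dvd_natAbs_norm`), `|N| = |s(0)|` for the
characteristic polynomial `s` of multiplication by `y = q(π t)`, whose complex roots are
`ψ(y) = q(ψ(π t)) = ∏_α (ψ(π t) − α)`. [cite: PastenShimura2024, proof of Thm. 7.2, p. 26] -/
theorem le_pow_of_dvd_congruenceModulus_ker {R O : Type*} [CommRing R] [CommRing O] [IsDomain O]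
    [Module.Free ℤ O] [Module.Finite ℤ O] (π : R →+* O) (hπ : Function.Surjective π)
    {P : Ideal R} {t : R} {q : ℤ[X]} (hq : q.Monic) (hqP : aeval t q ∈ P)
    (hy0 : π (aeval t q) ≠ 0) {Bx Bq : ℝ} (hBx : 0 ≤ Bx) (hBq : 0 ≤ Bq)
    (hx : ∀ ψ : O →+* ℂ, ‖ψ (π t)‖ ≤ Bx)
    (hroots : ∀ α : ℂ, (q.map (Int.castRingHom ℂ)).IsRoot α → ‖α‖ ≤ Bq)
    {ℓ : ℕ} (hdvd : ℓ ∣ congruenceModulus P (RingHom.ker π)) :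
    (ℓ : ℝ) ≤ ((Bx + Bq) ^ q.natDegree) ^ Module.finrank ℤ O := by
  classical
  obtain ⟨y, hy⟩ : ∃ y : O, y = π (aeval t q) := ⟨_, rfl⟩
  have hyq : y = aeval (π t) q := by
    have h1 := Polynomial.aeval_algHom_apply π.toIntAlgHom t q
    simp only [RingHom.toIntAlgHom_coe] at h1
    rw [hy, h1]
  have hy0' : y ≠ 0 := hy ▸ hy0
  -- `ℓ ∣ η ∣ |N(y)|`
  have hdvd' : ℓ ∣ (Algebra.norm ℤ y).natAbs := by
    rw [hy]
    exact hdvd.trans (congruenceModulus_ker_dvd_natAbs_norm π hπ hqP hy0)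
  have hnorm0 : (Algebra.norm ℤ y).natAbs ≠ 0 :=
    Int.natAbs_ne_zero.mpr (Algebra.norm_ne_zero_iff.mpr hy0')
  have hℓle : (ℓ : ℝ) ≤ ((Algebra.norm ℤ y).natAbs : ℝ) := by
    exact_mod_cast Nat.le_of_dvd (Nat.pos_of_ne_zero hnorm0) hdvd'
  -- `|N(y)| = |s(0)|`
  obtain ⟨s, hs⟩ : ∃ s : ℤ[X], s = (Algebra.lmul ℤ O y).charpoly := ⟨_, rfl⟩
  have hnorm_eq : ((Algebra.norm ℤ y).natAbs : ℝ) = |(s.coeff 0 : ℝ)| := by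
    have hdet := LinearMap.det_eq_sign_charpoly_coeff (Algebra.lmul ℤ O y)
    rw [← hs, ← Algebra.norm_apply] at hdet
    rw [Nat.cast_natAbs, Int.cast_abs, hdet, Int.cast_mul, Int.cast_pow, Int.cast_neg,
      Int.cast_one, abs_mul, abs_pow, abs_neg, abs_one, one_pow, one_mul]
  -- the roots of `s` are `q(ψ(π t))`, bounded by `(Bₓ + B_q)^{deg q}`
  have hsroots : ∀ μ : ℂ, (s.map (Int.castRingHom ℂ)).IsRoot μ →
      ‖μ‖ ≤ (Bx + Bq) ^ q.natDegree := by
    intro μ hμ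
    rw [hs] at hμ
    obtain ⟨ψ, hψ⟩ := exists_ringHom_apply_eq_of_isRoot_charpoly_lmul y hμ
    have hsplit : (q.map (Int.castRingHom ℂ)).Splits := IsAlgClosed.splits _
    have hmon : (q.map (Int.castRingHom ℂ)).Monic := hq.map _
    have hdeg : (q.map (Int.castRingHom ℂ)).natDegree = q.natDegree := hq.natDegree_map _
    rw [← hψ, hyq, ringHom_aeval_eq_eval_map, hsplit.eval_eq_prod_roots_of_monic hmon, ← hdeg,
      hsplit.natDegree_eq_card_roots,
      ← Multiset.card_map (ψ (π t) - ·) (q.map (Int.castRingHom ℂ)).roots]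
    refine norm_multisetProd_le_pow (by positivity) fun z hz ↦ ?_
    obtain ⟨α, hα, rfl⟩ := Multiset.mem_map.mp hz
    have hαroot : (q.map (Int.castRingHom ℂ)).IsRoot α :=
      (Polynomial.mem_roots hmon.ne_zero).mp hα
    calc ‖ψ (π t) - α‖ ≤ ‖ψ (π t)‖ + ‖α‖ := norm_sub_le _ _
      _ ≤ Bx + Bq := add_le_add (hx ψ) (hroots α hαroot)
  have hsmon : s.Monic := by rw [hs]; exact LinearMap.charpoly_monic _
  have hsdeg : s.natDegree = Module.finrank ℤ O := by rw [hs, LinearMap.charpoly_natDegree]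
  have hcoeff := abs_coeff_zero_le_pow_of_roots_le hsmon (by positivity) hsroots
  rw [hsdeg] at hcoeff
  exact hℓle.trans (hnorm_eq ▸ hcoeff)

/-! ### The known regime: `ℓ ≤ N^{22 d_P d_Q}` -/

/-- `rank_ℤ(𝕋 ⧸ P) ≤ 3 N⁴` for every minimal prime `P` of `𝕋 = anemicHeckeRing N 2` (from the
tree's count `Σ_P rank ≤ N/12 + (25/12) d(N)³ √N`, `sum_finrank_quotient_minimalPrimes_two_le`).
[cite: PastenShimura2024, Prop. 7.1 (p. 26)] -/
theorem finrank_quotient_le_three_mul_pow_four {P : Ideal (anemicHeckeRing N 2)}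
    (hP : P ∈ minimalPrimes (anemicHeckeRing N 2)) :
    (Module.finrank ℤ (anemicHeckeRing N 2 ⧸ P) : ℝ) ≤ 3 * (N : ℝ) ^ 4 := by
  classical
  have hmem : P ∈ (finite_minimalPrimes_anemicHeckeRing N 2).toFinset :=
    (finite_minimalPrimes_anemicHeckeRing N 2).mem_toFinset.mpr hP
  have h1 : (Module.finrank ℤ (anemicHeckeRing N 2 ⧸ P) : ℝ) ≤
      ((∑ P' ∈ (finite_minimalPrimes_anemicHeckeRing N 2).toFinset,
        Module.finrank ℤ (anemicHeckeRing N 2 ⧸ P') : ℕ) : ℝ) := by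
    exact_mod_cast Finset.single_le_sum (f := fun P' ↦ Module.finrank ℤ (anemicHeckeRing N 2 ⧸ P'))
      (fun _ _ ↦ Nat.zero_le _) hmem
  have h2 := sum_finrank_quotient_minimalPrimes_two_le N
  have hN1 : (1 : ℝ) ≤ N := by exact_mod_cast NeZero.one_le
  have hd : (N.divisors.card : ℝ) ≤ N := by exact_mod_cast Nat.card_divisors_le_self N
  have hsqrt : Real.sqrt N ≤ N := by
    rw [Real.sqrt_le_left (by linarith)]
    nlinarith
  have hd0 : (0 : ℝ) ≤ N.divisors.card := Nat.cast_nonneg _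
  have h3 : (N.divisors.card : ℝ) ^ 3 * Real.sqrt N ≤ (N : ℝ) ^ 4 :=
    calc (N.divisors.card : ℝ) ^ 3 * Real.sqrt N ≤ (N : ℝ) ^ 3 * N := by gcongr
      _ = (N : ℝ) ^ 4 := by ring
  have h3' : 25 / 12 * (N.divisors.card : ℝ) ^ 3 * Real.sqrt N ≤ 25 / 12 * (N : ℝ) ^ 4 := by
    rw [mul_assoc]
    exact mul_le_mul_of_nonneg_left h3 (by norm_num)
  have h4 : (N : ℝ) ≤ (N : ℝ) ^ 4 := by
    have := pow_le_pow_right₀ hN1 (show 1 ≤ 4 by norm_num)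
    rwa [pow_one] at this
  linarith

/-- **The known regime, for minimal primes (E-free, weight `2`, any level `N ≥ 2`).** For
distinct minimal primes `P ≠ Q` of `𝕋 = anemicHeckeRing N 2`, EVERY divisor `ℓ` of the congruence
modulus `#𝕋/(P+Q)` — in particular the modulus itself, which is therefore nonzero and
`≤ N^{22 d_P d_Q}`, and every congruence prime — satisfies
`ℓ ≤ N^{22 · rank_ℤ(𝕋/P) · rank_ℤ(𝕋/Q)}`. [cite: PastenShimura2024, proof of Thm. 7.2, p. 26] -/
theorem le_pow_of_dvd_congruenceModulus (hN : 2 ≤ N) {P Q : Ideal (anemicHeckeRing N 2)}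
    (hP : P ∈ minimalPrimes (anemicHeckeRing N 2)) (hQ : Q ∈ minimalPrimes (anemicHeckeRing N 2))
    (hPQ : P ≠ Q) {ℓ : ℕ} (hdvd : ℓ ∣ congruenceModulus P Q) :
    (ℓ : ℝ) ≤ (N : ℝ) ^ (22 * (Module.finrank ℤ (anemicHeckeRing N 2 ⧸ P) *
      Module.finrank ℤ (anemicHeckeRing N 2 ⧸ Q) : ℝ)) := by
  classical
  haveI : P.IsPrime := hP.1.1
  haveI : Q.IsPrime := hQ.1.1
  haveI := free_quotient_of_mem_minimalPrimes hP
  haveI := finite_quotient_anemicHeckeRing P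
  haveI := free_quotient_of_mem_minimalPrimes hQ
  haveI := finite_quotient_anemicHeckeRing Q
  set dP := Module.finrank ℤ (anemicHeckeRing N 2 ⧸ P) with hdP
  set dQ := Module.finrank ℤ (anemicHeckeRing N 2 ⧸ Q) with hdQ
  -- the separating element and its height
  obtain ⟨t, hbound, hsep⟩ := exists_separating_heckeElement hP hQ hPQ
  obtain ⟨Bt, hBt⟩ : ∃ Bt : ℝ, Bt = 8 * ((dP * dQ : ℕ) : ℝ) * (N : ℝ) ^ 6 := ⟨_, rfl⟩
  have hBt0 : 0 ≤ Bt := by rw [hBt]; positivity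
  replace hbound : ∀ ρ : anemicHeckeRing N 2 →+* ℂ, ‖ρ t‖ ≤ Bt := fun ρ ↦ by
    rw [hBt]; exact hbound ρ
  -- the characteristic polynomial `q` of `t` on `𝕋 ⧸ P`
  obtain ⟨q, hqmon, hqdeg, hqker, hqroots⟩ :=
    exists_monic_aeval_mem_ker (Ideal.Quotient.mk P) t
  rw [Ideal.mk_ker] at hqker
  -- its roots are values of `t` at complex points of `Spec 𝕋/P`, bounded by `B_t`
  have hroots : ∀ α : ℂ, (q.map (Int.castRingHom ℂ)).IsRoot α →
      ∃ ψ : anemicHeckeRing N 2 →+* ℂ, RingHom.ker ψ = P ∧ ψ t = α := by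
    intro α hα
    obtain ⟨ψP, hψP⟩ := hqroots α hα
    refine ⟨ψP.comp (Ideal.Quotient.mk P),
      ker_eq_of_mem_minimalPrimes_of_le _ hP fun a ha ↦ ?_, hψP⟩
    rw [RingHom.mem_ker, RingHom.comp_apply, Ideal.Quotient.eq_zero_iff_mem.mpr ha, map_zero]
  have hrootsB : ∀ α : ℂ, (q.map (Int.castRingHom ℂ)).IsRoot α → ‖α‖ ≤ Bt := by
    intro α hα
    obtain ⟨ψ, -, hψt⟩ := hroots α hα
    rw [← hψt]
    exact hbound ψ
  -- `q(t) mod Q ≠ 0`: a zero would put a complex point of `Spec 𝕋/Q` among the roots of `q`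
  have hy0 : Ideal.Quotient.mk Q (aeval t q) ≠ 0 := by
    intro hy0
    rw [Ideal.Quotient.eq_zero_iff_mem] at hy0
    obtain ⟨xg, g, hg, hφ0, hPφ⟩ := exists_isNewform0_eigenIdeal_eq_of_mem_minimalPrimes hQ
    have hker' : RingHom.ker (eigencharacter (isAnemicEigenvector_degeneracyMap0 xg hg) hφ0) = Q := by
      rw [ker_eigencharacter, ← hPφ]
    have hroot : (q.map (Int.castRingHom ℂ)).IsRoot
        (eigencharacter (isAnemicEigenvector_degeneracyMap0 xg hg) hφ0 t) := by
      have h1 : eigencharacter (isAnemicEigenvector_degeneracyMap0 xg hg) hφ0 (aeval t q) = 0 := by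
        rw [← RingHom.mem_ker, hker']
        exact hy0
      have h2 := ringHom_aeval_eq_eval_map
        (eigencharacter (isAnemicEigenvector_degeneracyMap0 xg hg) hφ0) t q
      exact h2.symm.trans h1
    obtain ⟨ψ, hψ, hψt⟩ := hroots _ hroot
    exact hsep ψ _ hψ hker' hψt
  -- the size mechanism on `𝕋 ⧸ Q`
  have hdvdker : ℓ ∣ congruenceModulus P (RingHom.ker (Ideal.Quotient.mk Q)) := by
    rwa [Ideal.mk_ker]
  have hmain := le_pow_of_dvd_congruenceModulus_ker (Ideal.Quotient.mk Q)
    Ideal.Quotient.mk_surjective hqmon hqker hy0 hBt0 hBt0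
    (fun ψ ↦ hbound (ψ.comp (Ideal.Quotient.mk Q))) hrootsB hdvdker
  rw [hqdeg, ← pow_mul] at hmain
  -- numerics: `(2 B_t)^{d_P d_Q} ≤ N^{22 d_P d_Q}` for `N ≥ 2`
  have hN2 : (2 : ℝ) ≤ N := by exact_mod_cast hN
  have hN1 : (1 : ℝ) ≤ N := by linarith
  have hdP3 : (dP : ℝ) ≤ 3 * (N : ℝ) ^ 4 := finrank_quotient_le_three_mul_pow_four hP
  have hdQ3 : (dQ : ℝ) ≤ 3 * (N : ℝ) ^ 4 := finrank_quotient_le_three_mul_pow_four hQ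
  have hbase : 2 * Bt ≤ (N : ℝ) ^ (22 : ℕ) := by
    have hK : ((dP * dQ : ℕ) : ℝ) ≤ 9 * (N : ℝ) ^ 8 := by
      rw [Nat.cast_mul]
      have hdP0 : (0 : ℝ) ≤ dP := Nat.cast_nonneg _
      have hdQ0 : (0 : ℝ) ≤ dQ := Nat.cast_nonneg _
      calc (dP : ℝ) * dQ ≤ (3 * (N : ℝ) ^ 4) * (3 * (N : ℝ) ^ 4) :=
            mul_le_mul hdP3 hdQ3 hdQ0 (by positivity)
        _ = 9 * (N : ℝ) ^ 8 := by ring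
    have h144 : (144 : ℝ) ≤ (N : ℝ) ^ 8 := by
      have : (2 : ℝ) ^ 8 ≤ (N : ℝ) ^ 8 := by gcongr
      linarith [show (144 : ℝ) ≤ (2 : ℝ) ^ 8 by norm_num]
    calc 2 * Bt = 16 * ((dP * dQ : ℕ) : ℝ) * (N : ℝ) ^ 6 := by rw [hBt]; ring
      _ ≤ 16 * (9 * (N : ℝ) ^ 8) * (N : ℝ) ^ 6 := by gcongr
      _ = 144 * (N : ℝ) ^ 14 := by ring
      _ ≤ (N : ℝ) ^ 8 * (N : ℝ) ^ 14 := by gcongr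
      _ = (N : ℝ) ^ (22 : ℕ) := by ring
  calc (ℓ : ℝ) ≤ (Bt + Bt) ^ (dP * dQ) := hmain
    _ = (2 * Bt) ^ (dP * dQ) := by ring
    _ ≤ ((N : ℝ) ^ (22 : ℕ)) ^ (dP * dQ) := by gcongr
    _ = (N : ℝ) ^ ((22 * (dP * dQ) : ℕ) : ℝ) := by rw [Real.rpow_natCast, ← pow_mul]
    _ = (N : ℝ) ^ (22 * (dP * dQ : ℝ)) := by norm_cast

/-- **The congruence modulus of two Galois orbits is itself polynomially bounded**:
`#𝕋/(P+Q) ≤ N^{22 d_P d_Q}` for distinct minimal primes `P ≠ Q` of `anemicHeckeRing N 2`,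
`N ≥ 2` (`le_pow_of_dvd_congruenceModulus` with `ℓ = #𝕋/(P+Q)`). [cite: PastenShimura2024, proof of Thm. 7.2, p. 26] -/
theorem congruenceModulus_le_pow (hN : 2 ≤ N) {P Q : Ideal (anemicHeckeRing N 2)}
    (hP : P ∈ minimalPrimes (anemicHeckeRing N 2)) (hQ : Q ∈ minimalPrimes (anemicHeckeRing N 2))
    (hPQ : P ≠ Q) :
    (congruenceModulus P Q : ℝ) ≤ (N : ℝ) ^ (22 * (Module.finrank ℤ (anemicHeckeRing N 2 ⧸ P) *
      Module.finrank ℤ (anemicHeckeRing N 2 ⧸ Q) : ℝ)) :=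
  le_pow_of_dvd_congruenceModulus hN hP hQ hPQ dvd_rfl

/-! ### The registered sub-goal: the bet's shape with the product of the dimensions -/

/-- Weight-`2` cusp forms of level `1` vanish (`Γ₀(1) = SL₂(ℤ)`, Mathlib
`CuspForm.rank_eq_zero_of_weight_lt_twelve`). [folklore] -/
theorem cuspForm_gamma0_one_weight_two_eq_zero (f : CuspForm (Gamma0 1) 2) : f = 0 := by
  have hΓ : ((Gamma0 1 : Subgroup (Matrix.SpecialLinearGroup (Fin 2) ℤ)) :
      Subgroup (GL (Fin 2) ℝ)) = 𝒮ℒ := by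
    have : Gamma0 1 = CongruenceSubgroup.Gamma 1 := by
      rw [CongruenceSubgroup.Gamma_one_top]; ext A; simp [eq_iff_true_of_subsingleton]
    rw [this]; exact CongruenceSubgroup.Gamma_one_coe_eq_SL
  suffices h : ∀ Γ : Subgroup (GL (Fin 2) ℝ), Γ = 𝒮ℒ → ∀ g : CuspForm Γ 2, g = 0 from h _ hΓ f
  rintro Γ rfl g
  exact rank_zero_iff_forall_zero.mp (CuspForm.rank_eq_zero_of_weight_lt_twelve (by norm_num)) g

/-- **Registered sub-goal `stub_gradedProductRegime` (line `newpart-congruence-friability`, crux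
stmt-ABC-2045): the KNOWN regime of the bet `stub_gradedNewPartFriability`, E-free.**  For
newforms `f, g ∈ S₂(Γ₀(N))` in distinct Galois orbits (`𝕀_f ≠ 𝕀_g`) and a prime `ℓ` dividing the
nonzero congruence modulus `η(f,[g]) = #𝕋/(𝕀_f + 𝕀_g)`:
`ℓ ≤ C · N^{κ · d_f · d_g}`, `d = rank_ℤ(𝕋/𝕀)` the orbit dimension, with `κ = 22`, `C = 1`, at
every level (no squarefree hypothesis).  The bet replaces `d_f · d_g` by `d_f`; the tree had
`d_f = 1` (`log_heckeCongruenceModulus_le_finrank_mul_three_mul_log`).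
[cite: PastenShimura2024, proof of Thm. 7.2, p. 26] -/
theorem stub_gradedProductRegime :
    ∃ κ C : ℝ, ∀ (N : ℕ) [NeZero N] (f g : CuspForm (Gamma0 N) 2), IsNewform0 f → IsNewform0 g →
      eigenIdeal f ≠ eigenIdeal g → ∀ ℓ : ℕ, ℓ.Prime → heckeCongruenceModulus f (eigenIdeal g) ≠ 0 →
        ℓ ∣ heckeCongruenceModulus f (eigenIdeal g) →
        (ℓ : ℝ) ≤ C * (N : ℝ) ^ (κ * ((Module.finrank ℤ (anemicHeckeRing N 2 ⧸ eigenIdeal f) : ℝ) *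
          (Module.finrank ℤ (anemicHeckeRing N 2 ⧸ eigenIdeal g) : ℝ))) := by
  refine ⟨22, 1, fun N _ f g hf hg hne ℓ _ _ hdvd ↦ ?_⟩
  rw [one_mul]
  -- `N ≥ 2`: at level `1` there are no newforms of weight `2`
  have hN : 2 ≤ N := by
    by_contra hlt
    have hN1 : N = 1 := by have := NeZero.one_le (n := N); omega
    subst hN1
    exact newform_ne_zero hf (cuspForm_gamma0_one_weight_two_eq_zero f)
  have h := le_pow_of_dvd_congruenceModulus hN (newform_eigenIdeal_mem_minimalPrimes hf)
    (newform_eigenIdeal_mem_minimalPrimes hg) hne hdvd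
  convert h using 2

end Summit.ABC.ABC.Theorems.DegreePrimesPolyBounded

end
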